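import Literature.Analysis.SpecialFunctions.SpheroidalHarmonicBranch
import HarnessLib

/-!
# Global real eigenvalue branches of the `m`-spheroidal equation by continuation

Topic `Literature/Analysis/SpecialFunctions` (namespace `Literature.Analysis.SpecialFunctions`),
continuing `SpheroidalHarmonicBranch.lean`. There: through every real zero `(ν₀, κ₀)` of the real
shooting function `F_ℝ = shootRe m` passes a locally unique `C^∞` real branch of zeros with slope
in `(−1, 0)`. Here these germs are continued along a compact range of the spheroidicity
parameter: **for every real zero `(ν_b, 0)` (e.g. the Legendre values `ν_b = n(n+2m+1)`, `n` even,
`SpheroidalHarmonicLegendre.lean`) and every `a < 0` there is a continuous function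
`ν : ℝ → ℝ` with `ν(0) = ν_b`, `F_ℝ(ν(κ), κ) = 0` for all `κ ∈ [a, 0]`, and `ν` `1`-Lipschitz**
(`exists_eigenBranch`) — the real eigenvalue curve `λ(κ) = ν(κ) + m(m+1)` of the even
Sturm–Liouville problem on `κ ∈ [a, 0]`, with `|λ(κ) − λ(0)| ≤ |κ|` (Shlapentokh-Rothman, CMP 329
(2014), App. B, Props. B.1–B.3: the eigenvalues as functions of the spheroidicity parameter).

Proof (continuation; all proved): call `EigGood τ g` a continuous `1`-Lipschitz curve of zeros on
`[τ, 0]` with `g(0) = ν_b`. Two such curves agree (`good_unique`: the coincidence set is clopen in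
the connected `[τ, 0]` by local uniqueness of branches); a curve on `[τ, 0]` extends to
`[τ − ε, 0]` (`good_extend`: glue the local branch at `(g(τ), τ)`, whose strict derivative has norm
`< 1`, hence is `1`-Lipschitz nearby, `HasStrictFDerivAt.exists_lipschitzOnWith_of_nnnorm_lt`);
the infimum `t₀` of the good left endpoints above `a` is attained (the union of the curves is
`1`-Lipschitz on `(t₀, 0]`, extend by McShane `LipschitzOnWith.extend_real`, the zero persists by
continuity), so `t₀ = a`.

## References

* Y. Shlapentokh-Rothman, Comm. Math. Phys. 329 (2014) 859–891, App. B (Props. B.1–B.3).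
  Key `ShlapentokhRothman2014KleinGordon`.
-/

noncomputable section

open Set Filter Metric Topology
open scoped ContDiff NNReal

namespace Literature.Analysis.SpecialFunctions

open Literature.Analysis.ODE Literature.Analysis.Calculus

variable (m : ℕ) (νb : ℝ)

/-! ### Good curves of zeros on `[τ, 0]` -/

/-- A **good curve** on `[τ, 0]`: continuous, `1`-Lipschitz, zeros of the real shooting function,
normalised by `g(0) = ν_b`. [folklore] -/
structure EigGood (τ : ℝ) (g : ℝ → ℝ) : Prop where
  hτ : τ ≤ 0
  cont : ContinuousOn g (Icc τ 0)
  base : g 0 = νb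
  zero : ∀ κ ∈ Icc τ 0, shootRe m (g κ, κ) = 0
  lip : ∀ κ ∈ Icc τ 0, ∀ κ' ∈ Icc τ 0, |g κ - g κ'| ≤ |κ - κ'|

variable {m νb}

/-- Restriction of a good curve to a shorter interval. [folklore] -/
theorem EigGood.mono {τ τ' : ℝ} {g : ℝ → ℝ} (h : EigGood m νb τ g) (hτ : τ ≤ τ') (hτ' : τ' ≤ 0) : EigGood m νb τ' g where
  hτ := hτ'
  cont := h.cont.mono (Icc_subset_Icc_left hτ)
  base := h.base
  zero := fun κ hκ ↦ h.zero κ (Icc_subset_Icc_left hτ hκ)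
  lip := fun κ hκ κ' hκ' ↦ h.lip κ (Icc_subset_Icc_left hτ hκ) κ' (Icc_subset_Icc_left hτ hκ')

/-- **Local coincidence**: two good curves agreeing at `κ₀ ∈ [τ, 0]` agree near `κ₀` within
`[τ, 0]` (local uniqueness of the real branch through the real zero `(g₁ κ₀, κ₀)`). [folklore] -/
theorem EigGood.eventually_eq {τ : ℝ} {g₁ g₂ : ℝ → ℝ} (h₁ : EigGood m νb τ g₁) (h₂ : EigGood m νb τ g₂) {κ₀ : ℝ}
    (hκ₀ : κ₀ ∈ Icc τ 0) (heq : g₁ κ₀ = g₂ κ₀) : ∀ᶠ κ in 𝓝[Icc τ 0] κ₀, g₁ κ = g₂ κ := by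
  obtain ⟨gl, -, -, -, huniq, -⟩ := exists_realBranch m (ν₀ := g₁ κ₀) (κ₀ := κ₀) (h₁.zero κ₀ hκ₀)
  -- the curves `κ ↦ (gᵢ κ, κ)` tend to `(g₁ κ₀, κ₀)` within `[τ, 0]`
  have ht₁ : Tendsto (fun κ ↦ (g₁ κ, κ)) (𝓝[Icc τ 0] κ₀) (𝓝 (g₁ κ₀, κ₀)) :=
    ((h₁.cont κ₀ hκ₀).tendsto).prodMk_nhds (tendsto_nhdsWithin_of_tendsto_nhds tendsto_id)
  have ht₂ : Tendsto (fun κ ↦ (g₂ κ, κ)) (𝓝[Icc τ 0] κ₀) (𝓝 (g₁ κ₀, κ₀)) := by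
    rw [heq]
    exact ((h₂.cont κ₀ hκ₀).tendsto).prodMk_nhds (tendsto_nhdsWithin_of_tendsto_nhds tendsto_id)
  have e₁ := ht₁.eventually huniq
  have e₂ := ht₂.eventually huniq
  have hz : ∀ᶠ κ in 𝓝[Icc τ 0] κ₀, κ ∈ Icc τ 0 := eventually_mem_nhdsWithin
  filter_upwards [e₁, e₂, hz] with κ hκ₁ hκ₂ hκ
  rw [hκ₁ (h₁.zero κ hκ), hκ₂ (h₂.zero κ hκ)]

/-- **Uniqueness of good curves**: two good curves on `[τ, 0]` coincide there (the coincidence set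
is non-empty (`0`), closed, and open in the connected `[τ, 0]`). [folklore] -/
theorem good_unique {τ : ℝ} {g₁ g₂ : ℝ → ℝ} (h₁ : EigGood m νb τ g₁) (h₂ : EigGood m νb τ g₂) : EqOn g₁ g₂ (Icc τ 0) := by
  -- work in the connected subtype `X = [τ, 0]`
  haveI : PreconnectedSpace (Icc τ 0) := Subtype.preconnectedSpace isPreconnected_Icc
  set Z : Set (Icc τ 0) := {x | g₁ x = g₂ x} with hZ
  have hclosed : IsClosed Z := by
    have hc₁ : Continuous fun x : Icc τ 0 ↦ g₁ x := h₁.cont.restrict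
    have hc₂ : Continuous fun x : Icc τ 0 ↦ g₂ x := h₂.cont.restrict
    exact isClosed_eq hc₁ hc₂
  have hopen : IsOpen Z := by
    rw [isOpen_iff_mem_nhds]
    intro x hx
    have hev := h₁.eventually_eq h₂ x.2 hx
    -- transfer the `nhdsWithin` statement to the subtype
    rw [eventually_nhdsWithin_iff, Metric.eventually_nhds_iff] at hev
    obtain ⟨ε, hε, hball⟩ := hev
    have hB : Metric.ball x ε ∈ 𝓝 x := Metric.ball_mem_nhds x hε
    refine Filter.mem_of_superset hB fun y hy ↦ ?_
    exact hball hy y.2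
  have hne : Z.Nonempty := ⟨⟨0, ⟨h₁.hτ, le_rfl⟩⟩, by simp [hZ, h₁.base, h₂.base]⟩
  have hall : Z = univ := IsClopen.eq_univ ⟨hclosed, hopen⟩ hne
  intro κ hκ
  have : (⟨κ, hκ⟩ : Icc τ 0) ∈ Z := by rw [hall]; trivial
  exact this

/-! ### Extension of a good curve past its left endpoint -/

/-- **The local branch at a real zero is `1`-Lipschitz near its base point** (its strict
derivative has norm `ρ < 1`). [folklore] -/
theorem exists_lipschitz_branch {ν₀ κ₀ : ℝ} (h0 : shootRe m (ν₀, κ₀) = 0) :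
    ∃ h : ℝ → ℝ, h κ₀ = ν₀ ∧ ∃ ε > (0 : ℝ), (∀ κ ∈ Icc (κ₀ - ε) (κ₀ + ε), shootRe m (h κ, κ) = 0) ∧
      LipschitzOnWith 1 h (Icc (κ₀ - ε) (κ₀ + ε)) := by
  obtain ⟨h, hh0, hhC, hhz, -, ρ, hρ0, hρ1, hhd⟩ := exists_realBranch m h0
  -- strict differentiability from smoothness, with derivative `−ρ`
  have hstrict : HasStrictDerivAt h (-ρ) κ₀ := by
    have hs := hhC.hasStrictDerivAt (by simp)
    rwa [hhd.deriv] at hs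
  have hnorm : ‖(ContinuousLinearMap.smulRight (1 : ℝ →L[ℝ] ℝ) (-ρ))‖₊ < 1 := by
    rw [show ‖(ContinuousLinearMap.smulRight (1 : ℝ →L[ℝ] ℝ) (-ρ))‖₊ = ‖-ρ‖₊ by simp]
    rw [← NNReal.coe_lt_coe, coe_nnnorm, norm_neg, Real.norm_eq_abs, abs_of_pos hρ0]
    exact_mod_cast hρ1
  obtain ⟨s, hs, hlip⟩ := hstrict.hasStrictFDerivAt.exists_lipschitzOnWith_of_nnnorm_lt 1 hnorm
  -- a symmetric closed interval inside `s` and inside the zero set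
  obtain ⟨ε₁, hε₁, hball₁⟩ := Metric.mem_nhds_iff.1 hs
  obtain ⟨ε₂, hε₂, hball₂⟩ := Metric.eventually_nhds_iff.1 hhz
  refine ⟨h, hh0, min ε₁ ε₂ / 2, by positivity, fun κ hκ ↦ ?_, hlip.mono fun κ hκ ↦ hball₁ ?_⟩
  · refine hball₂ ?_
    rw [Real.dist_eq, abs_lt]
    constructor <;> linarith [hκ.1, hκ.2, min_le_right ε₁ ε₂]
  · rw [Metric.mem_ball, Real.dist_eq, abs_lt]
    constructor <;> linarith [hκ.1, hκ.2, min_le_left ε₁ ε₂]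

/-- **Extension step**: a good curve on `[τ, 0]` extends to a good curve on `[τ − ε, 0]` for some
`ε > 0`, agreeing with it on `[τ, 0]` (glue the local branch through `(g τ, τ)`). [folklore] -/
theorem good_extend {τ : ℝ} {g : ℝ → ℝ} (hg : EigGood m νb τ g) :
    ∃ ε > (0 : ℝ), ∃ g' : ℝ → ℝ, EigGood m νb (τ - ε) g' ∧ EqOn g' g (Icc τ 0) := by
  have hτ0 : τ ∈ Icc τ 0 := ⟨le_rfl, hg.hτ⟩
  obtain ⟨h, hhτ, ε, hε, hzero, hlip⟩ := exists_lipschitz_branch (m := m) (hg.zero τ hτ0)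
  set g' : ℝ → ℝ := fun κ ↦ if κ ≤ τ then h κ else g κ with hg'
  have hg'_of_le : ∀ {κ}, κ ≤ τ → g' κ = h κ := fun hκ ↦ by simp [hg', hκ]
  have hg'_of_ge : ∀ {κ}, τ ≤ κ → g' κ = g κ := fun {κ} hκ ↦ by
    rcases hκ.eq_or_lt with h' | h'
    · simp [hg', ← h', hhτ]
    · simp [hg', not_le.2 h']
  have hlipI : ∀ κ ∈ Icc (τ - ε) τ, ∀ κ' ∈ Icc (τ - ε) τ, |h κ - h κ'| ≤ |κ - κ'| := by
    intro κ hκ κ' hκ'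
    have hsub : Icc (τ - ε) τ ⊆ Icc (τ - ε) (τ + ε) := Icc_subset_Icc_right (by linarith)
    have := hlip.dist_le_mul κ (hsub hκ) κ' (hsub hκ')
    simpa [Real.dist_eq] using this
  refine ⟨ε, hε, g', ⟨by linarith [hg.hτ], ?_, ?_, ?_, ?_⟩, fun κ hκ ↦ hg'_of_ge hκ.1⟩
  · -- continuity by pasting at `τ`
    have hcl : Icc (τ - ε) 0 ∩ closure {κ : ℝ | κ ≤ τ} ⊆ Icc (τ - ε) τ := by
      rw [show {κ : ℝ | κ ≤ τ} = Iic τ from rfl, closure_Iic]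
      intro κ hκ; exact ⟨hκ.1.1, hκ.2⟩
    have hcr : Icc (τ - ε) 0 ∩ closure {κ : ℝ | ¬κ ≤ τ} ⊆ Icc τ 0 := by
      rw [show {κ : ℝ | ¬κ ≤ τ} = Ioi τ by ext; simp, closure_Ioi]
      intro κ hκ; exact ⟨hκ.2, hκ.1.2⟩
    refine ContinuousOn.if ?_ ((hlip.continuousOn.mono ((hcl.trans (Icc_subset_Icc_right (by linarith))))))
      (hg.cont.mono hcr)
    intro κ hκ
    have hfr : κ ∈ frontier {κ : ℝ | κ ≤ τ} := hκ.2
    rw [show {κ : ℝ | κ ≤ τ} = Iic τ from rfl, frontier_Iic] at hfr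
    rw [mem_singleton_iff.1 hfr, hhτ]
  · -- base point
    rcases le_or_gt 0 τ with h0 | h0
    · have : τ = 0 := le_antisymm hg.hτ h0
      rw [hg'_of_le (by linarith), ← hg.base, ← this, hhτ]
    · rw [hg'_of_ge h0.le, hg.base]
  · -- zeros
    intro κ hκ
    rcases le_or_gt κ τ with hle | hgt
    · rw [hg'_of_le hle]
      exact hzero κ ⟨hκ.1, by linarith⟩
    · rw [hg'_of_ge hgt.le]
      exact hg.zero κ ⟨hgt.le, hκ.2⟩
  · -- `1`-Lipschitz, with the junction estimate through `τ`
    have key : ∀ κ ∈ Icc (τ - ε) 0, ∀ κ' ∈ Icc (τ - ε) 0, κ ≤ κ' → |g' κ - g' κ'| ≤ |κ - κ'| := by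
      intro κ hκ κ' hκ' hle
      rcases le_or_gt κ' τ with h1 | h1
      · -- both on the left
        rw [hg'_of_le (hle.trans h1), hg'_of_le h1]
        exact hlipI κ ⟨hκ.1, hle.trans h1⟩ κ' ⟨hκ'.1, h1⟩
      · rcases le_or_gt τ κ with h2 | h2
        · -- both on the right
          rw [hg'_of_ge h2, hg'_of_ge h1.le]
          exact hg.lip κ ⟨h2, hκ.2⟩ κ' ⟨h1.le, hκ'.2⟩
        · -- `κ < τ < κ'`: through `τ`
          rw [hg'_of_le h2.le, hg'_of_ge h1.le]
          have e1 := hlipI κ ⟨hκ.1, h2.le⟩ τ ⟨by linarith, le_rfl⟩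
          have e2 := hg.lip τ hτ0 κ' ⟨h1.le, hκ'.2⟩
          rw [hhτ] at e1
          calc |h κ - g κ'| = |(h κ - g τ) + (g τ - g κ')| := by ring_nf
            _ ≤ |h κ - g τ| + |g τ - g κ'| := abs_add_le _ _
            _ ≤ |κ - τ| + |τ - κ'| := add_le_add e1 e2
            _ = |κ - κ'| := by
                rw [abs_of_nonpos (by linarith), abs_of_nonpos (by linarith), abs_of_nonpos (by linarith)]
                ring
    intro κ hκ κ' hκ'
    rcases le_or_gt κ κ' with hle | hgt
    · exact key κ hκ κ' hκ' hle
    · rw [abs_sub_comm, abs_sub_comm κ]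
      exact key κ' hκ' κ hκ hgt.le

/-! ### The continuation -/

/-- **Global real eigenvalue branches by continuation.** For every real zero `(ν_b, 0)` of the
shooting function and every `a < 0` there is `ν : ℝ → ℝ`, continuous on `[a, 0]`, with
`ν(0) = ν_b`, `F_ℝ(ν(κ), κ) = 0` on `[a, 0]`, and `|ν(κ) − ν(κ')| ≤ |κ − κ'|` there (in particular
`|ν(κ) − ν_b| ≤ |κ|`) — the even angular eigenvalue curve `λ(κ) = ν(κ) + m(m+1)` of the
`m`-spheroidal problem followed from spheroidicity `0` down to `a` (at each of its points it is
the locally unique real branch of `SpheroidalHarmonicBranch.lean`, hence `C^∞`, with slope in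
`(−1, 0)`, and the germ of a holomorphic curve). SR, CMP 329 (2014), App. B.
[cite: ShlapentokhRothman2014KleinGordon, App. B] -/
theorem exists_eigenBranch (hb : shootRe m (νb, 0) = 0) {a : ℝ} (ha : a < 0) :
    ∃ ν : ℝ → ℝ, EigGood m νb a ν := by
  -- good left endpoints above `a`
  set T : Set ℝ := {τ | a ≤ τ ∧ ∃ g, EigGood m νb τ g} with hT
  have h0T : (0 : ℝ) ∈ T := by
    refine ⟨ha.le, fun _ ↦ νb, ⟨le_rfl, continuousOn_const, rfl, fun κ hκ ↦ ?_, fun κ _ κ' _ ↦ by simp [abs_nonneg]⟩⟩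
    have : κ = 0 := le_antisymm hκ.2 hκ.1
    rw [this]; exact hb
  have hTne : T.Nonempty := ⟨0, h0T⟩
  have hTbdd : BddBelow T := ⟨a, fun τ hτ ↦ hτ.1⟩
  set t₀ := sInf T with ht₀
  have hat₀ : a ≤ t₀ := le_csInf hTne fun τ hτ ↦ hτ.1
  have ht₀0 : t₀ ≤ 0 := csInf_le hTbdd h0T
  have hTle : ∀ τ ∈ T, τ ≤ 0 := fun τ ⟨_, g, hg⟩ ↦ hg.hτ
  -- the constant curve at `0` is good, and extends: so `t₀ < 0`
  have hconst : EigGood m νb 0 (fun _ ↦ νb) :=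
    ⟨le_rfl, continuousOn_const, rfl, fun κ hκ ↦ by rw [le_antisymm hκ.2 hκ.1]; exact hb,
      fun κ _ κ' _ ↦ by simp [abs_nonneg]⟩
  have ht₀neg : t₀ < 0 := by
    obtain ⟨ε, hε, g', hg', -⟩ := good_extend hconst
    have hmem : max a (0 - ε) ∈ T :=
      ⟨le_max_left _ _, g', hg'.mono (le_max_right _ _) (max_le ha.le (by linarith))⟩
    have hle : t₀ ≤ max a (0 - ε) := csInf_le hTbdd hmem
    have : max a (0 - ε) < 0 := max_lt ha (by linarith)
    linarith
  -- for every `κ ∈ (t₀, 0]` there is a good curve on `[τ, 0]` with `τ < κ`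
  have hgood : ∀ κ, t₀ < κ → κ ≤ 0 → ∃ τ g, τ ∈ T ∧ τ < κ ∧ EigGood m νb τ g := by
    intro κ hκ _
    obtain ⟨τ, hτT, hτκ⟩ := exists_lt_of_csInf_lt hTne hκ
    obtain ⟨haτ, g, hg⟩ := hτT
    exact ⟨τ, g, ⟨haτ, g, hg⟩, hτκ, hg⟩
  -- the union curve on `(t₀, 0]` (values chosen; independent of the choice by uniqueness)
  classical
  set ν₁ : ℝ → ℝ := fun κ ↦ if h : t₀ < κ ∧ κ ≤ 0 then (hgood κ h.1 h.2).choose_spec.choose κ else νb with hν₁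
  have hν₁_eq : ∀ {τ : ℝ} {g : ℝ → ℝ}, EigGood m νb τ g → t₀ ≤ τ → ∀ κ ∈ Ioc τ 0, t₀ < κ → ν₁ κ = g κ := by
    intro τ g hg hτ κ hκ hκt
    have hdef : ν₁ κ = (hgood κ hκt hκ.2).choose_spec.choose κ := by simp [hν₁, hκt, hκ.2]
    rw [hdef]
    set τ' := (hgood κ hκt hκ.2).choose with hτ'
    obtain ⟨-, hτ'κ, hg'⟩ := (hgood κ hκt hκ.2).choose_spec.choose_spec
    -- compare on `[max τ τ', 0]`
    have h1 : EigGood m νb (max τ τ') ((hgood κ hκt hκ.2).choose_spec.choose) := hg'.mono (le_max_right _ _) (by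
      exact max_le hg.hτ hg'.hτ)
    have h2 : EigGood m νb (max τ τ') g := hg.mono (le_max_left _ _) (max_le hg.hτ hg'.hτ)
    exact good_unique h1 h2 ⟨max_le hκ.1.le hτ'κ.le, hκ.2⟩
  -- `ν₁` is `1`-Lipschitz and a zero curve on `(t₀, 0]`, with `ν₁ 0 = νb`
  have hpair : ∀ κ ∈ Ioc t₀ 0, ∀ κ' ∈ Ioc t₀ 0, ∃ τ g, EigGood m νb τ g ∧ t₀ ≤ τ ∧ τ < κ ∧ τ < κ' := by
    intro κ hκ κ' hκ'
    obtain ⟨τ, g, hτT, hτκ, hg⟩ := hgood (min κ κ') (lt_min hκ.1 hκ'.1) ((min_le_left _ _).trans hκ.2)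
    exact ⟨τ, g, hg, csInf_le hTbdd hτT, lt_of_lt_of_le hτκ (min_le_left _ _), lt_of_lt_of_le hτκ (min_le_right _ _)⟩
  have hlip₁ : LipschitzOnWith 1 ν₁ (Ioc t₀ 0) := by
    rw [lipschitzOnWith_iff_dist_le_mul]
    intro κ hκ κ' hκ'
    obtain ⟨τ, g, hg, hτ, hτκ, hτκ'⟩ := hpair κ hκ κ' hκ'
    rw [hν₁_eq hg hτ κ ⟨hτκ, hκ.2⟩ hκ.1, hν₁_eq hg hτ κ' ⟨hτκ', hκ'.2⟩ hκ'.1, NNReal.coe_one, one_mul,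
      Real.dist_eq, Real.dist_eq]
    exact hg.lip κ ⟨hτκ.le, hκ.2⟩ κ' ⟨hτκ'.le, hκ'.2⟩
  have hzero₁ : ∀ κ ∈ Ioc t₀ 0, shootRe m (ν₁ κ, κ) = 0 := by
    intro κ hκ
    obtain ⟨τ, g, hg, hτ, hτκ, -⟩ := hpair κ hκ κ hκ
    rw [hν₁_eq hg hτ κ ⟨hτκ, hκ.2⟩ hκ.1]
    exact hg.zero κ ⟨hτκ.le, hκ.2⟩
  -- McShane extension to a globally `1`-Lipschitz function
  obtain ⟨ν, hνlip, hνeq⟩ := hlip₁.extend_real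
  have hνcont : Continuous ν := hνlip.continuous
  -- `EigGood t₀ ν`
  have hGood : EigGood m νb t₀ ν := by
    refine ⟨ht₀0, hνcont.continuousOn, ?_, ?_, ?_⟩
    · -- base point (`t₀ < 0`)
      rw [← hνeq ⟨ht₀neg, le_rfl⟩]
      obtain ⟨τ, g, hg, hτ, hτ0, -⟩ := hpair 0 ⟨ht₀neg, le_rfl⟩ 0 ⟨ht₀neg, le_rfl⟩
      rw [hν₁_eq hg hτ 0 ⟨hτ0, le_rfl⟩ ht₀neg, hg.base]
    · intro κ hκ
      rcases hκ.1.eq_or_lt with heq | hlt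
      · -- at `t₀`: limit of zeros
        have hcl : t₀ ∈ closure (Ioc t₀ 0) := by
          rw [closure_Ioc ht₀neg.ne]; exact ⟨le_rfl, ht₀0⟩
        have hcont2 : Continuous fun κ ↦ shootRe m (ν κ, κ) :=
          (contDiff_shootRe m).continuous.comp (hνcont.prodMk continuous_id)
        have hsub : Ioc t₀ 0 ⊆ {κ | shootRe m (ν κ, κ) = 0} := fun κ' hκ' ↦ by
          show shootRe m (ν κ', κ') = 0
          rw [← hνeq hκ']; exact hzero₁ κ' hκ'
        have hz := (closure_minimal hsub (isClosed_eq hcont2 continuous_const)) hcl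
        rw [← heq]
        exact hz
      · rw [← hνeq ⟨hlt, hκ.2⟩]
        exact hzero₁ κ ⟨hlt, hκ.2⟩
    · intro κ _ κ' _
      have := hνlip.dist_le_mul κ κ'
      simpa [Real.dist_eq] using this
  -- minimality forces `t₀ = a`
  have ht₀T : t₀ ∈ T := ⟨hat₀, ν, hGood⟩
  rcases hat₀.eq_or_lt with heq | hlt
  · rw [heq]; exact ⟨ν, heq ▸ hGood⟩
  · exfalso
    obtain ⟨ε, hε, g', hg', -⟩ := good_extend hGood
    -- `max a (t₀ - ε) ∈ T` and is `< t₀`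
    have hmem : max a (t₀ - ε) ∈ T :=
      ⟨le_max_left _ _, g', hg'.mono (le_max_right _ _) ((max_le hlt.le (by linarith)).trans ht₀0)⟩
    have hle : t₀ ≤ max a (t₀ - ε) := csInf_le hTbdd hmem
    have : max a (t₀ - ε) < t₀ := max_lt hlt (by linarith)
    linarith

end Literature.Analysis.SpecialFunctions

end
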